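import Summits.Ventures.HodgeRepro2.T5SU11KernelIteratedDerivative

/-!
# The iterated derivatives of the composed kernels: `∂ᵏ_μ K_μ^{∘(n+1)} = (n+1)(n+2)⋯(n+k) K_μ^{∘(n+k+1)}`

Row 580's `∂_μ K_μ^{∘(n+1)}(t, s) = (n + 1) K_μ^{∘(n+2)}(t, s)`, iterated with `n` moving (the same induction as row 580's
`iteratedDeriv_kernel_mu`, which is the case `n = 0`):

* `iteratedDeriv_kernel_comp_mu` — **`iteratedDeriv k (μ ↦ K_{λ(μ)}^{∘(n+1)}(t, s)) μ₂ = (n+k)!/n! · K_{λ(μ₂)}^{∘(n+k+1)}(t, s)`**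
  at every `μ₂ > −1`, the factor written as the descending factorial `Nat.descFactorial (n + k) k`;
* `iteratedDeriv_kernel_comp_mu'` — the same at `μ₂ = λ₂(λ₂ − 2)`, `λ₂ > 1`.

Here `K_λ^{∘(n+1)}(t, s) = (G^I_λ)ⁿ K_λ(·, s)(t)` and `λ(μ) = 1 + √(μ + 1)`. Nothing is claimed about (N).

Blind lane: Mathlib + the HodgeRepro2 prefix only; no sorry; axioms ⊆ {propext, Classical.choice,
Quot.sound}.
-/

namespace Summit.Ventures.HodgeRepro2.T5SU11KernelCompositionIteratedDerivative

open Filter Topology MeasureTheory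
open Set (Ioi Ioc)
open T5SU11Cartan T5SU11SphericalFunction T5SU11SphericalDecay T5SU11RadialGreenKernel T5SU11RadialGreenImproper
  T5SU11ResolventDerivativeMu T5SU11KernelIteratedDerivative

section measure

variable [MeasurableSpace Circle] [BorelSpace Circle]

variable {s : ℝ} (hs : 0 < s)

include hs in
/-- **THE ITERATED DERIVATIVES OF THE COMPOSED KERNELS**:
`iteratedDeriv k (μ ↦ (G^I_{λ(μ)})ⁿ K_{λ(μ)}(·, s)(t)) μ₂ = (n+k)!/n! · (G^I_{λ(μ₂)})^{n+k} K_{λ(μ₂)}(·, s)(t)` for every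
`k`, `n` and `μ₂ > −1` — `∂ᵏ_μ K_μ^{∘(n+1)} = (n+1)(n+2)⋯(n+k) K_μ^{∘(n+k+1)}`. -/
theorem iteratedDeriv_kernel_comp_mu (k n : ℕ) {μ₂ : ℝ} (hμ₂ : -1 < μ₂) {t : ℝ} (ht : 0 < t) :
    iteratedDeriv k (fun μ => ((greenSolI (fun t => sph (1 + Real.sqrt (μ + 1)) (hyp t))
        (sphDecay (1 + Real.sqrt (μ + 1))))^[n] (fun r => sphGreenKernel (1 + Real.sqrt (μ + 1)) r s)) t) μ₂
      = ((n + k).descFactorial k : ℝ) * ((greenSolI (fun t => sph (1 + Real.sqrt (μ₂ + 1)) (hyp t))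
        (sphDecay (1 + Real.sqrt (μ₂ + 1))))^[n + k] (fun r => sphGreenKernel (1 + Real.sqrt (μ₂ + 1)) r s)) t := by
  suffices h : ∀ μ₂ : ℝ, -1 < μ₂ →
      iteratedDeriv k (fun μ => ((greenSolI (fun t => sph (1 + Real.sqrt (μ + 1)) (hyp t))
          (sphDecay (1 + Real.sqrt (μ + 1))))^[n] (fun r => sphGreenKernel (1 + Real.sqrt (μ + 1)) r s)) t) μ₂
        = ((n + k).descFactorial k : ℝ) * ((greenSolI (fun t => sph (1 + Real.sqrt (μ₂ + 1)) (hyp t))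
          (sphDecay (1 + Real.sqrt (μ₂ + 1))))^[n + k] (fun r => sphGreenKernel (1 + Real.sqrt (μ₂ + 1)) r s)) t
    from h μ₂ hμ₂
  induction k with
  | zero =>
    intro μ₂ _
    simp
  | succ k ih =>
    intro μ₂ hμ₂
    rw [iteratedDeriv_succ]
    have hev : (iteratedDeriv k (fun μ => ((greenSolI (fun t => sph (1 + Real.sqrt (μ + 1)) (hyp t))
          (sphDecay (1 + Real.sqrt (μ + 1))))^[n] (fun r => sphGreenKernel (1 + Real.sqrt (μ + 1)) r s)) t))
        =ᶠ[𝓝 μ₂] fun μ => ((n + k).descFactorial k : ℝ) * ((greenSolI (fun t => sph (1 + Real.sqrt (μ + 1)) (hyp t))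
          (sphDecay (1 + Real.sqrt (μ + 1))))^[n + k] (fun r => sphGreenKernel (1 + Real.sqrt (μ + 1)) r s)) t := by
      filter_upwards [eventually_gt_nhds hμ₂] with μ hμ
      exact ih μ hμ
    rw [hev.deriv_eq]
    have hd := (hasDerivAt_kernel_comp_mu hs (n + k) hμ₂ ht).const_mul ((n + k).descFactorial k : ℝ)
    rw [hd.deriv, show n + (k + 1) = n + k + 1 by ring, Nat.succ_descFactorial_succ]
    push_cast
    ring

include hs in
/-- The iterated derivatives of the composed kernels at `μ₂ = λ₂(λ₂ − 2)`, `λ₂ > 1`: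
`iteratedDeriv k (μ ↦ (G^I_{λ(μ)})ⁿ K_{λ(μ)}(·, s)(t)) (λ₂(λ₂ − 2)) = (n+k)!/n! · (G^I_{λ₂})^{n+k} K_{λ₂}(·, s)(t)`. -/
theorem iteratedDeriv_kernel_comp_mu' (k n : ℕ) {lam₂ : ℝ} (hlam₂ : 1 < lam₂) {t : ℝ} (ht : 0 < t) :
    iteratedDeriv k (fun μ => ((greenSolI (fun t => sph (1 + Real.sqrt (μ + 1)) (hyp t))
        (sphDecay (1 + Real.sqrt (μ + 1))))^[n] (fun r => sphGreenKernel (1 + Real.sqrt (μ + 1)) r s)) t)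
        (lam₂ * (lam₂ - 2))
      = ((n + k).descFactorial k : ℝ) * ((greenSolI (fun t => sph lam₂ (hyp t)) (sphDecay lam₂))^[n + k]
        (fun r => sphGreenKernel lam₂ r s)) t := by
  have hμ₂ : -1 < lam₂ * (lam₂ - 2) := by nlinarith
  rw [iteratedDeriv_kernel_comp_mu hs k n hμ₂ ht, one_add_sqrt_eq hlam₂]

end measure

end Summit.Ventures.HodgeRepro2.T5SU11KernelCompositionIteratedDerivative
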